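import Mathlib.AlgebraicGeometry.EllipticCurve.DivisionPolynomial.Basic
import Mathlib.Algebra.TrivSqZeroExt.Basic
import Mathlib.RingTheory.Ideal.Quotient.Operations
import Mathlib.Tactic
import HarnessLib

/-!
# Division polynomials to first order at the cusp: `ψₙ` of `y² = x³ + ax + b` modulo `(a, b)²`

For the short Weierstrass equation `E : y² = x³ + a x + b` the univariate division polynomials
`preΨₙ ∈ ℤ[a, b][x]` (Mathlib's `WeierstrassCurve.preΨ'`: `ψₙ` for odd `n`, `ψₙ/ψ₂` for even `n`)
specialise at the cuspidal cubic `a = b = 0` to `n x^{(n²-1)/2}` (odd `n`), `(n/2) x^{(n²-4)/2}`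
(even `n`). This file computes them **to first order in `(a, b)`**:

* odd `n`:  `preΨₙ ≡ n x^{(n²-1)/2} + [n(n²-1)(n²+6)/60] a x^{(n²-5)/2}
                      + [n(n²-1)(n⁴+n²+15)/210] b x^{(n²-7)/2}   (mod (a, b)²)`,
* even `n`: `preΨₙ ≡ (n/2) x^{(n²-4)/2} + [n(n²-4)(n²+9)/120] a x^{(n²-8)/2}
                      + [n(n²-4)(n⁴+4n²+30)/420] b x^{(n²-10)/2}  (mod (a, b)²)`

(`preΨ'_eval_sub_cuspLinear_mem`; over `ℂ` these are the first Laurent coefficients of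
`σ(nz)/σ(z)^{n²}` against `℘ = z⁻² - (a/5)z² - (b/7)z⁴ - …`, `σ = z + (a/60)z⁵ + (b/210)z⁷ + …`;
here they are obtained algebraically, by running Mathlib's recursion `preNormEDS'` in the ring
of first-order jets `R[εₐ, ε_b]/(εₐ, ε_b)² = TrivSqZeroExt R (R × R)` and mapping to `R/(a, b)²`).
The statement is over any commutative ring `R` in which `840 = 2³·3·5·7` is invertible
(`w` with `840 w = 1` carries the denominators `60, 120, 210, 420`).

Consequence used by `MazurTorsionStepOneAtNProofs` (Mazur 1977, Ch. III §5, Step 1 at `q = N`):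
for a prime `p ≥ 11` both first-order coefficients of `preΨ_p` carry the factor `p`, so for
`a, b ∈ pR` and a unit `x`, `preΨ_p(x) ≡ p·x^{(p²-1)/2} (mod p²)`: a point with unit abscissa on
an additive fibre is not `p`-torsion. (For `p = 5, 7` the coefficients `62 = ψ₅`'s and
`3944 = ψ₇`'s are not divisible by `p` — `840` is not a unit — matching the existence of rational
`5`- and `7`-torsion with additive reduction at `p`.)

## References

* [SilvermanAEC2009] J. H. Silverman, *The Arithmetic of Elliptic Curves*, 2nd ed. (2009),
  Exercise 3.7 (PDF pp. 97–98): the recursion for `ψₙ`, (a) the univariate forms, (b) the leading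
  terms `ψₘ² = m²x^{m²-1} + …`; the first-order terms are computed in this file.
* [Mazur1977] B. Mazur, *Modular curves and the Eisenstein ideal*, Publ. Math. IHÉS 47 (1977),
  Ch. III §5, Step 1, p. 158.

## Design

`jet u₀ u₁ u₂ = u₀ + u₁εₐ + u₂ε_b : TrivSqZeroExt R (R × R)` with its multiplication table
(`jet_mul`); the closed forms `cuspJetOdd j` (index `2j+3`), `cuspJetEven j` (index `2j+4`) are
written with polynomial exponents in `j` so that `ring` verifies the recursion; `cuspJet n`
dispatches on `n`. The transfer to `R/(a,b)²` is the ring homomorphism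
`jetQuotHom : jet u₀ u₁ u₂ ↦ u₀ + a u₁ + b u₂ (mod (a,b)²)`.
-/

noncomputable section

namespace Literature.NumberTheory.EllipticCurves.CuspJets

variable {R : Type*} [CommRing R]

/-! ## §1 First-order jets -/

/-- The first-order jet `u₀ + u₁ εₐ + u₂ ε_b` in `R[εₐ, ε_b]/(εₐ, ε_b)² = TrivSqZeroExt R (R × R)`.
[folklore] -/
def jet (u₀ u₁ u₂ : R) : TrivSqZeroExt R (R × R) := (u₀, (u₁, u₂))

omit [CommRing R] in
/-- Zeroth-order part of a jet. [folklore] -/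
@[simp] theorem fst_jet (u₀ u₁ u₂ : R) : (jet u₀ u₁ u₂).fst = u₀ := rfl

omit [CommRing R] in
/-- First-order part of a jet. [folklore] -/
@[simp] theorem snd_jet (u₀ u₁ u₂ : R) : (jet u₀ u₁ u₂).snd = (u₁, u₂) := rfl

/-- Multiplication of jets: `εₐ² = εₐ ε_b = ε_b² = 0`. [folklore] -/
theorem jet_mul (u₀ u₁ u₂ v₀ v₁ v₂ : R) :
    jet u₀ u₁ u₂ * jet v₀ v₁ v₂ = jet (u₀ * v₀) (u₀ * v₁ + v₀ * u₁) (u₀ * v₂ + v₀ * u₂) := by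
  refine TrivSqZeroExt.ext ?_ ?_
  · simp [jet, TrivSqZeroExt.fst_mul]
  · simp [jet, TrivSqZeroExt.snd_mul, mul_comm u₁ v₀, mul_comm u₂ v₀]

/-- Addition of jets. [folklore] -/
theorem jet_add (u₀ u₁ u₂ v₀ v₁ v₂ : R) :
    jet u₀ u₁ u₂ + jet v₀ v₁ v₂ = jet (u₀ + v₀) (u₁ + v₁) (u₂ + v₂) := rfl

/-- Subtraction of jets. [folklore] -/
theorem jet_sub (u₀ u₁ u₂ v₀ v₁ v₂ : R) :
    jet u₀ u₁ u₂ - jet v₀ v₁ v₂ = jet (u₀ - v₀) (u₁ - v₁) (u₂ - v₂) := rfl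

/-- `1 = 1 + 0εₐ + 0ε_b`. [folklore] -/
theorem one_eq_jet : (1 : TrivSqZeroExt R (R × R)) = jet 1 0 0 := rfl

/-- `0 = 0 + 0εₐ + 0ε_b`. [folklore] -/
theorem zero_eq_jet : (0 : TrivSqZeroExt R (R × R)) = jet 0 0 0 := rfl

/-- Squares of jets. [folklore] -/
theorem jet_pow_two (u₀ u₁ u₂ : R) :
    jet u₀ u₁ u₂ ^ 2 = jet (u₀ ^ 2) (2 * u₀ * u₁) (2 * u₀ * u₂) := by
  rw [pow_two, jet_mul]; congr 1 <;> ring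

/-- Cubes of jets. [folklore] -/
theorem jet_pow_three (u₀ u₁ u₂ : R) :
    jet u₀ u₁ u₂ ^ 3 = jet (u₀ ^ 3) (3 * u₀ ^ 2 * u₁) (3 * u₀ ^ 2 * u₂) := by
  rw [pow_succ, jet_pow_two, jet_mul]; congr 1 <;> ring

omit [CommRing R] in
/-- Jets with equal components are equal. [folklore] -/
theorem jet_congr {u₀ u₁ u₂ v₀ v₁ v₂ : R} (h₀ : u₀ = v₀) (h₁ : u₁ = v₁) (h₂ : u₂ = v₂) :
    jet u₀ u₁ u₂ = jet v₀ v₁ v₂ := by rw [h₀, h₁, h₂]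

/-! ## §2 The closed forms and the jets of `Ψ₂Sq²`, `Ψ₃`, `preΨ₄` -/

variable (x w : R)

/-- The closed form at odd index `n = 2j + 3`:
`n x^{(n²-1)/2} + 14n(n²-1)(n²+6)w · x^{(n²-5)/2} εₐ + 4n(n²-1)(n⁴+n²+15)w · x^{(n²-7)/2} ε_b`
(`w` stands for `1/840`). [cite: SilvermanAEC2009, Exercise 3.7(a),(b) (PDF pp. 97–98)] -/
def cuspJetOdd (j : ℕ) : TrivSqZeroExt R (R × R) :=
  jet ((2 * j + 3 : R) * x ^ (2 * j ^ 2 + 6 * j + 4))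
    (14 * (2 * j + 3 : R) * ((2 * j + 3) ^ 2 - 1) * ((2 * j + 3) ^ 2 + 6) * w *
      x ^ (2 * j ^ 2 + 6 * j + 2))
    (4 * (2 * j + 3 : R) * ((2 * j + 3) ^ 2 - 1) * (((2 * j + 3) ^ 2) ^ 2 + (2 * j + 3) ^ 2 + 15) *
      w * x ^ (2 * j ^ 2 + 6 * j + 1))

/-- The closed form at even index `n = 2j + 4`:
`(n/2) x^{(n²-4)/2} + 7n(n²-4)(n²+9)w · x^{(n²-8)/2} εₐ + 2n(n²-4)(n⁴+4n²+30)w · x^{(n²-10)/2} ε_b`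
(`w` stands for `1/840`). [cite: SilvermanAEC2009, Exercise 3.7(a),(b) (PDF pp. 97–98)] -/
def cuspJetEven (j : ℕ) : TrivSqZeroExt R (R × R) :=
  jet ((j + 2 : R) * x ^ (2 * j ^ 2 + 8 * j + 6))
    (7 * (2 * j + 4 : R) * ((2 * j + 4) ^ 2 - 4) * ((2 * j + 4) ^ 2 + 9) * w *
      x ^ (2 * j ^ 2 + 8 * j + 4))
    (2 * (2 * j + 4 : R) * ((2 * j + 4) ^ 2 - 4) * (((2 * j + 4) ^ 2) ^ 2 + 4 * (2 * j + 4) ^ 2 + 30) *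
      w * x ^ (2 * j ^ 2 + 8 * j + 3))

/-- The closed form at every index (`0, 1, 1` at `n = 0, 1, 2`).
[cite: SilvermanAEC2009, Exercise 3.7(a),(b) (PDF pp. 97–98)] -/
def cuspJet : ℕ → TrivSqZeroExt R (R × R)
  | 0 => 0
  | 1 => 1
  | 2 => 1
  | (n + 3) => if Even n then cuspJetOdd x w (n / 2) else cuspJetEven x w ((n - 1) / 2)

/-- `cuspJet 0 = 0`. [folklore] -/
@[simp] theorem cuspJet_zero : cuspJet x w 0 = 0 := rfl
/-- `cuspJet 1 = 1`. [folklore] -/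
@[simp] theorem cuspJet_one : cuspJet x w 1 = 1 := rfl
/-- `cuspJet 2 = 1`. [folklore] -/
@[simp] theorem cuspJet_two : cuspJet x w 2 = 1 := rfl

/-- `cuspJet (2j+3)` is the odd closed form. [folklore] -/
theorem cuspJet_odd (j : ℕ) : cuspJet x w (2 * j + 3) = cuspJetOdd x w j := by
  rw [cuspJet, if_pos (even_two_mul j), Nat.mul_div_cancel_left j two_pos]

/-- `cuspJet (2j+4)` is the even closed form. [folklore] -/
theorem cuspJet_even (j : ℕ) : cuspJet x w (2 * j + 4) = cuspJetEven x w j := by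
  rw [show 2 * j + 4 = (2 * j + 1) + 3 by ring, cuspJet, if_neg (Nat.not_even_two_mul_add_one j),
    Nat.add_sub_cancel, Nat.mul_div_cancel_left j two_pos]

/-- Jet of `Ψ₂Sq² = 16(x³ + ax + b)² ≡ 16x⁶ + 32x⁴ a + 32x³ b`, written with `32 = 26880 w`.
[folklore] -/
def betaJet : TrivSqZeroExt R (R × R) := jet (16 * x ^ 6) (26880 * w * x ^ 4) (26880 * w * x ^ 3)

/-- Jet of `Ψ₃ = 3x⁴ + 6ax² + 12bx - a² ≡ 3x⁴ + 6x² a + 12x b`: the closed form at `n = 3`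
(`6 = 5040 w`, `12 = 10080 w`). [folklore] -/
abbrev gammaJet : TrivSqZeroExt R (R × R) := cuspJetOdd x w 0

/-- Jet of `preΨ₄ ≡ 2x⁶ + 10x⁴ a + 40x³ b`: the closed form at `n = 4` (`10 = 8400 w`,
`40 = 33600 w`). [folklore] -/
abbrev deltaJet : TrivSqZeroExt R (R × R) := cuspJetEven x w 0

/-! ## §3 The recursion in the jet ring -/

section Recursion

variable {x w}

local notation "S" => preNormEDS' (betaJet x w) (gammaJet x w) (deltaJet x w)

/-- `n = 0`. [folklore] -/
theorem S_zero : S 0 = cuspJet x w 0 := by rw [preNormEDS'_zero, cuspJet_zero]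

/-- `n = 1`. [folklore] -/
theorem S_one : S 1 = cuspJet x w 1 := by rw [preNormEDS'_one, cuspJet_one]

/-- `n = 2`. [folklore] -/
theorem S_two : S 2 = cuspJet x w 2 := by rw [preNormEDS'_two, cuspJet_two]

/-- `n = 3` (the parameter `c`). [folklore] -/
theorem S_three : S 3 = cuspJet x w 3 := by
  rw [preNormEDS'_three, show (3 : ℕ) = 2 * 0 + 3 by rfl, cuspJet_odd]

/-- `n = 4` (the parameter `d`). [folklore] -/
theorem S_four : S 4 = cuspJet x w 4 := by
  rw [preNormEDS'_four, show (4 : ℕ) = 2 * 0 + 4 by rfl, cuspJet_even]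

/-- `n = 5` from `1, 2, 3, 4`. [folklore] -/
theorem S_five : S 5 = cuspJet x w 5 := by
  rw [show (5 : ℕ) = 2 * (0 + 2) + 1 by rfl, preNormEDS'_odd, if_pos Even.zero, if_pos Even.zero]
  conv_rhs => rw [show 2 * (0 + 2) + 1 = 2 * 1 + 3 by rfl, cuspJet_odd]
  rw [zero_add, zero_add, zero_add, preNormEDS'_four, preNormEDS'_two, preNormEDS'_one,
    preNormEDS'_three]
  simp only [one_pow, mul_one, one_mul]
  simp only [betaJet, gammaJet, deltaJet, cuspJetOdd, cuspJetEven, jet_mul, jet_pow_three, jet_sub]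
  push_cast
  refine jet_congr ?_ ?_ ?_ <;> ring

/-- `n = 6` from `1, …, 5`. [folklore] -/
theorem S_six : S 6 = cuspJet x w 6 := by
  rw [show (6 : ℕ) = 2 * (0 + 3) by rfl, preNormEDS'_even]
  conv_rhs => rw [show 2 * (0 + 3) = 2 * 1 + 4 by rfl, cuspJet_even]
  rw [zero_add, zero_add, zero_add, zero_add, preNormEDS'_two, preNormEDS'_one, preNormEDS'_four,
    preNormEDS'_three, S_five, show (5 : ℕ) = 2 * 1 + 3 by rfl, cuspJet_odd]
  simp only [one_pow, one_mul]
  simp only [gammaJet, deltaJet, cuspJetOdd, cuspJetEven, jet_mul, jet_pow_two, jet_sub]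
  push_cast
  refine jet_congr ?_ ?_ ?_ <;> ring

/-- `n = 7` from `2, …, 5`. [folklore] -/
theorem S_seven : S 7 = cuspJet x w 7 := by
  have h1 : ¬ Even 1 := Nat.not_even_one
  rw [show (7 : ℕ) = 2 * (1 + 2) + 1 by rfl, preNormEDS'_odd, if_neg h1, if_neg h1]
  conv_rhs => rw [show 2 * (1 + 2) + 1 = 2 * 2 + 3 by rfl, cuspJet_odd]
  rw [show 1 + 4 = 5 by rfl, show 1 + 2 = 3 by rfl, show 1 + 1 = 2 by rfl, show 1 + 3 = 4 by rfl,
    preNormEDS'_two, preNormEDS'_four, preNormEDS'_three, S_five,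
    show (5 : ℕ) = 2 * 1 + 3 by rfl, cuspJet_odd]
  simp only [mul_one, one_mul]
  simp only [betaJet, gammaJet, deltaJet, cuspJetOdd, cuspJetEven, jet_mul, jet_pow_three, jet_sub]
  push_cast
  refine jet_congr ?_ ?_ ?_ <;> ring

/-- `n = 8` from `2, …, 6`. [folklore] -/
theorem S_eight : S 8 = cuspJet x w 8 := by
  rw [show (8 : ℕ) = 2 * (1 + 3) by rfl, preNormEDS'_even]
  conv_rhs => rw [show 2 * (1 + 3) = 2 * 2 + 4 by rfl, cuspJet_even]
  rw [show 1 + 4 = 5 by rfl, show 1 + 2 = 3 by rfl, show 1 + 1 = 2 by rfl, show 1 + 3 = 4 by rfl,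
    show 1 + 5 = 6 by rfl, preNormEDS'_two, preNormEDS'_four, preNormEDS'_three, S_five, S_six,
    show (5 : ℕ) = 2 * 1 + 3 by rfl, cuspJet_odd, show (6 : ℕ) = 2 * 1 + 4 by rfl, cuspJet_even]
  simp only [one_mul]
  simp only [gammaJet, deltaJet, cuspJetOdd, cuspJetEven, jet_mul, jet_pow_two, jet_sub]
  push_cast
  refine jet_congr ?_ ?_ ?_ <;> ring

/-- Generic odd step, `m = 2j + 2`: index `4j + 9` from `2j+3, 2j+4, 2j+5, 2j+6`. [folklore] -/
theorem step_odd_even (j : ℕ) (h1 : S (2 * j + 3) = cuspJet x w (2 * j + 3))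
    (h2 : S (2 * j + 4) = cuspJet x w (2 * j + 4)) (h3 : S (2 * j + 5) = cuspJet x w (2 * j + 5))
    (h4 : S (2 * j + 6) = cuspJet x w (2 * j + 6)) :
    S (2 * (2 * j + 2 + 2) + 1) = cuspJet x w (2 * (2 * j + 2 + 2) + 1) := by
  have he : Even (2 * j + 2) := ⟨j + 1, by ring⟩
  rw [preNormEDS'_odd, if_pos he, if_pos he, mul_one]
  conv_rhs => rw [show 2 * (2 * j + 2 + 2) + 1 = 2 * (2 * j + 3) + 3 by ring, cuspJet_odd]
  rw [show 2 * j + 2 + 4 = 2 * j + 6 by ring, show 2 * j + 2 + 2 = 2 * j + 4 by ring,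
    show 2 * j + 2 + 1 = 2 * j + 3 by ring, show 2 * j + 2 + 3 = 2 * j + 5 by ring, h1, h2, h3, h4,
    cuspJet_odd, cuspJet_even, show 2 * j + 5 = 2 * (j + 1) + 3 by ring, cuspJet_odd,
    show 2 * j + 6 = 2 * (j + 1) + 4 by ring, cuspJet_even]
  simp only [betaJet, cuspJetOdd, cuspJetEven, jet_mul, jet_pow_three, jet_sub]
  push_cast
  refine jet_congr ?_ ?_ ?_ <;> ring

/-- Generic odd step, `m = 2j + 3`: index `4j + 11` from `2j+4, 2j+5, 2j+6, 2j+7`. [folklore] -/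
theorem step_odd_odd (j : ℕ) (h1 : S (2 * j + 4) = cuspJet x w (2 * j + 4))
    (h2 : S (2 * j + 5) = cuspJet x w (2 * j + 5)) (h3 : S (2 * j + 6) = cuspJet x w (2 * j + 6))
    (h4 : S (2 * j + 7) = cuspJet x w (2 * j + 7)) :
    S (2 * (2 * j + 3 + 2) + 1) = cuspJet x w (2 * (2 * j + 3 + 2) + 1) := by
  have ho : ¬ Even (2 * j + 3) := by
    rw [Nat.not_even_iff_odd]; exact ⟨j + 1, by ring⟩
  rw [preNormEDS'_odd, if_neg ho, if_neg ho, mul_one]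
  conv_rhs => rw [show 2 * (2 * j + 3 + 2) + 1 = 2 * (2 * j + 4) + 3 by ring, cuspJet_odd]
  rw [show 2 * j + 3 + 4 = 2 * j + 7 by ring, show 2 * j + 3 + 2 = 2 * j + 5 by ring,
    show 2 * j + 3 + 1 = 2 * j + 4 by ring, show 2 * j + 3 + 3 = 2 * j + 6 by ring, h1, h2, h3, h4,
    cuspJet_even, show 2 * j + 5 = 2 * (j + 1) + 3 by ring, cuspJet_odd,
    show 2 * j + 6 = 2 * (j + 1) + 4 by ring, cuspJet_even,
    show 2 * j + 7 = 2 * (j + 2) + 3 by ring, cuspJet_odd]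
  simp only [betaJet, cuspJetOdd, cuspJetEven, jet_mul, jet_pow_three, jet_sub]
  push_cast
  refine jet_congr ?_ ?_ ?_ <;> ring

/-- Generic even step, `m = 2j + 2`: index `4j + 10` from `2j+3, …, 2j+7`. [folklore] -/
theorem step_even_even (j : ℕ) (h1 : S (2 * j + 3) = cuspJet x w (2 * j + 3))
    (h2 : S (2 * j + 4) = cuspJet x w (2 * j + 4)) (h3 : S (2 * j + 5) = cuspJet x w (2 * j + 5))
    (h4 : S (2 * j + 6) = cuspJet x w (2 * j + 6)) (h5 : S (2 * j + 7) = cuspJet x w (2 * j + 7)) :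
    S (2 * (2 * j + 2 + 3)) = cuspJet x w (2 * (2 * j + 2 + 3)) := by
  rw [preNormEDS'_even]
  conv_rhs => rw [show 2 * (2 * j + 2 + 3) = 2 * (2 * j + 3) + 4 by ring, cuspJet_even]
  rw [show 2 * j + 2 + 1 = 2 * j + 3 by ring, show 2 * j + 2 + 2 = 2 * j + 4 by ring,
    show 2 * j + 2 + 3 = 2 * j + 5 by ring, show 2 * j + 2 + 4 = 2 * j + 6 by ring,
    show 2 * j + 2 + 5 = 2 * j + 7 by ring, h1, h2, h3, h4, h5,
    cuspJet_odd, cuspJet_even, show 2 * j + 5 = 2 * (j + 1) + 3 by ring, cuspJet_odd,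
    show 2 * j + 6 = 2 * (j + 1) + 4 by ring, cuspJet_even,
    show 2 * j + 7 = 2 * (j + 2) + 3 by ring, cuspJet_odd]
  simp only [cuspJetOdd, cuspJetEven, jet_mul, jet_pow_two, jet_sub]
  push_cast
  refine jet_congr ?_ ?_ ?_ <;> ring

/-- Generic even step, `m = 2j + 3`: index `4j + 12` from `2j+4, …, 2j+8`. [folklore] -/
theorem step_even_odd (j : ℕ) (h1 : S (2 * j + 4) = cuspJet x w (2 * j + 4))
    (h2 : S (2 * j + 5) = cuspJet x w (2 * j + 5)) (h3 : S (2 * j + 6) = cuspJet x w (2 * j + 6))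
    (h4 : S (2 * j + 7) = cuspJet x w (2 * j + 7)) (h5 : S (2 * j + 8) = cuspJet x w (2 * j + 8)) :
    S (2 * (2 * j + 3 + 3)) = cuspJet x w (2 * (2 * j + 3 + 3)) := by
  rw [preNormEDS'_even]
  conv_rhs => rw [show 2 * (2 * j + 3 + 3) = 2 * (2 * j + 4) + 4 by ring, cuspJet_even]
  rw [show 2 * j + 3 + 1 = 2 * j + 4 by ring, show 2 * j + 3 + 2 = 2 * j + 5 by ring,
    show 2 * j + 3 + 3 = 2 * j + 6 by ring, show 2 * j + 3 + 4 = 2 * j + 7 by ring,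
    show 2 * j + 3 + 5 = 2 * j + 8 by ring, h1, h2, h3, h4, h5,
    cuspJet_even, show 2 * j + 5 = 2 * (j + 1) + 3 by ring, cuspJet_odd,
    show 2 * j + 6 = 2 * (j + 1) + 4 by ring, cuspJet_even,
    show 2 * j + 7 = 2 * (j + 2) + 3 by ring, cuspJet_odd,
    show 2 * j + 8 = 2 * (j + 2) + 4 by ring, cuspJet_even]
  simp only [cuspJetOdd, cuspJetEven, jet_mul, jet_pow_two, jet_sub]
  push_cast
  refine jet_congr ?_ ?_ ?_ <;> ring

/-- **The division polynomials of `y² = x³ + ax + b` to first order in `(a, b)`, in the jet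
ring**: Mathlib's recursion `preNormEDS'` run on the jets of `(Ψ₂Sq², Ψ₃, preΨ₄)` returns the
closed forms `cuspJet` at every index (an identity in `w`; `w = 1/840` is needed only to identify
the three initial jets, `§4`). [cite: SilvermanAEC2009, Exercise 3.7(a),(b) (PDF pp. 97–98)] -/
theorem preNormEDS'_jet (n : ℕ) : S n = cuspJet x w n := by
  induction n using normEDSRec' with
  | zero => exact S_zero
  | one => exact S_one
  | two => exact S_two
  | three => exact S_three
  | four => exact S_four
  | even m ih =>
    obtain ⟨i, rfl | rfl⟩ := Nat.even_or_odd' m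
    · cases i with
      | zero => exact S_six
      | succ j =>
        rw [show 2 * (j + 1) = 2 * j + 2 by ring]
        exact step_even_even j (ih _ (by omega)) (ih _ (by omega)) (ih _ (by omega))
          (ih _ (by omega)) (ih _ (by omega))
    · cases i with
      | zero => exact S_eight
      | succ j =>
        rw [show 2 * (j + 1) + 1 = 2 * j + 3 by ring]
        exact step_even_odd j (ih _ (by omega)) (ih _ (by omega)) (ih _ (by omega))
          (ih _ (by omega)) (ih _ (by omega))
  | odd m ih =>
    obtain ⟨i, rfl | rfl⟩ := Nat.even_or_odd' m
    · cases i with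
      | zero => exact S_five
      | succ j =>
        rw [show 2 * (j + 1) = 2 * j + 2 by ring]
        exact step_odd_even j (ih _ (by omega)) (ih _ (by omega)) (ih _ (by omega))
          (ih _ (by omega))
    · cases i with
      | zero => exact S_seven
      | succ j =>
        rw [show 2 * (j + 1) + 1 = 2 * j + 3 by ring]
        exact step_odd_odd j (ih _ (by omega)) (ih _ (by omega)) (ih _ (by omega))
          (ih _ (by omega))

end Recursion

/-! ## §4 Transfer to `R/(a, b)²`: the division polynomials of `y² = x³ + ax + b` -/

section Transfer

variable (a b : R)

/-- The short Weierstrass equation `y² = x³ + ax + b`. [folklore] -/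
abbrev shortCurve : WeierstrassCurve R := ⟨0, 0, 0, a, b⟩

/-- The ideal `(a, b)²`. [folklore] -/
abbrev cuspIdealSq : Ideal R := (Ideal.span {a, b}) ^ 2

/-- `a ∈ (a, b)`. [folklore] -/
theorem mem_span_left : a ∈ Ideal.span ({a, b} : Set R) := Ideal.subset_span (by simp)

/-- `b ∈ (a, b)`. [folklore] -/
theorem mem_span_right : b ∈ Ideal.span ({a, b} : Set R) := Ideal.subset_span (by simp)

/-- `a²s + abt + b²u ∈ (a, b)²`. [folklore] -/
theorem key_mem (s t u : R) : a * a * s + a * b * t + b * b * u ∈ cuspIdealSq a b := by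
  have haa : a * a ∈ cuspIdealSq a b := by
    rw [cuspIdealSq, pow_two]; exact Ideal.mul_mem_mul (mem_span_left a b) (mem_span_left a b)
  have hab : a * b ∈ cuspIdealSq a b := by
    rw [cuspIdealSq, pow_two]; exact Ideal.mul_mem_mul (mem_span_left a b) (mem_span_right a b)
  have hbb : b * b ∈ cuspIdealSq a b := by
    rw [cuspIdealSq, pow_two]; exact Ideal.mul_mem_mul (mem_span_right a b) (mem_span_right a b)
  exact add_mem (add_mem (Ideal.mul_mem_right _ _ haa) (Ideal.mul_mem_right _ _ hab))
    (Ideal.mul_mem_right _ _ hbb)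

/-- **The transfer homomorphism** `R[εₐ, ε_b]/(εₐ, ε_b)² → R/(a, b)²`,
`u₀ + u₁εₐ + u₂ε_b ↦ u₀ + a u₁ + b u₂`: well defined and multiplicative because
`a², ab, b² ∈ (a, b)²`. [folklore] -/
def jetQuotHom : TrivSqZeroExt R (R × R) →+* R ⧸ cuspIdealSq a b where
  toFun z := Ideal.Quotient.mk _ (z.fst + a * z.snd.1 + b * z.snd.2)
  map_one' := by simp
  map_mul' z z' := by
    rw [show z = jet z.fst z.snd.1 z.snd.2 from rfl, show z' = jet z'.fst z'.snd.1 z'.snd.2 from rfl,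
      jet_mul]
    simp only [fst_jet, snd_jet, ← map_mul, Ideal.Quotient.eq]
    convert key_mem a b (-(z.snd.1 * z'.snd.1)) (-(z.snd.1 * z'.snd.2 + z.snd.2 * z'.snd.1))
      (-(z.snd.2 * z'.snd.2)) using 1
    ring
  map_zero' := by simp
  map_add' z z' := by
    simp only [TrivSqZeroExt.fst_add, TrivSqZeroExt.snd_add, Prod.fst_add, Prod.snd_add, ← map_add]
    congr 1
    ring

/-- The transfer homomorphism on a jet. [folklore] -/
theorem jetQuotHom_jet (u₀ u₁ u₂ : R) :
    jetQuotHom a b (jet u₀ u₁ u₂) = Ideal.Quotient.mk _ (u₀ + a * u₁ + b * u₂) := rfl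

variable {w} (hw : 840 * w = 1)
include hw

/-- `Ψ₂Sq² = 16(x³ + ax + b)² ↦ betaJet`. [folklore] -/
theorem mk_eval_Ψ₂Sq_sq :
    Ideal.Quotient.mk (cuspIdealSq a b) (((shortCurve a b).Ψ₂Sq ^ 2).eval x) =
      jetQuotHom a b (betaJet x w) := by
  rw [betaJet, jetQuotHom_jet, Ideal.Quotient.eq]
  have e : ((shortCurve a b).Ψ₂Sq ^ 2).eval x = 16 * (x ^ 3 + a * x + b) ^ 2 := by
    simp only [WeierstrassCurve.Ψ₂Sq, WeierstrassCurve.b₂, WeierstrassCurve.b₄,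
      WeierstrassCurve.b₆, Polynomial.eval_pow, Polynomial.eval_add, Polynomial.eval_mul,
      Polynomial.eval_C, Polynomial.eval_X]
    ring
  rw [e]
  convert key_mem a b (16 * x ^ 2) (32 * x) 16 using 1
  linear_combination (-(32 : R) * a * x ^ 4 - 32 * b * x ^ 3) * hw

/-- `Ψ₃ = 3x⁴ + 6ax² + 12bx - a² ↦ gammaJet`. [folklore] -/
theorem mk_eval_Ψ₃ :
    Ideal.Quotient.mk (cuspIdealSq a b) ((shortCurve a b).Ψ₃.eval x) =
      jetQuotHom a b (gammaJet x w) := by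
  rw [gammaJet, cuspJetOdd, jetQuotHom_jet, Ideal.Quotient.eq]
  have e : (shortCurve a b).Ψ₃.eval x = 3 * x ^ 4 + 6 * a * x ^ 2 + 12 * b * x - a ^ 2 := by
    simp only [WeierstrassCurve.Ψ₃, WeierstrassCurve.b₂, WeierstrassCurve.b₄,
      WeierstrassCurve.b₆, WeierstrassCurve.b₈, Polynomial.eval_add,
      Polynomial.eval_mul, Polynomial.eval_C, Polynomial.eval_X, Polynomial.eval_pow,
      Polynomial.eval_ofNat]
    ring
  rw [e]
  push_cast
  convert key_mem a b (-1) 0 0 using 1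
  linear_combination (-(6 : R) * a * x ^ 2 - 12 * b * x) * hw

/-- `preΨ₄ = 2x⁶ + 10ax⁴ + 40bx³ - 10a²x² - 8abx - 2a³ - 16b² ↦ deltaJet`. [folklore] -/
theorem mk_eval_preΨ₄ :
    Ideal.Quotient.mk (cuspIdealSq a b) ((shortCurve a b).preΨ₄.eval x) =
      jetQuotHom a b (deltaJet x w) := by
  rw [deltaJet, cuspJetEven, jetQuotHom_jet, Ideal.Quotient.eq]
  have e : (shortCurve a b).preΨ₄.eval x = 2 * x ^ 6 + 10 * a * x ^ 4 + 40 * b * x ^ 3 -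
      10 * a ^ 2 * x ^ 2 - 8 * a * b * x - 2 * a ^ 3 - 16 * b ^ 2 := by
    simp only [WeierstrassCurve.preΨ₄, WeierstrassCurve.b₂, WeierstrassCurve.b₄,
      WeierstrassCurve.b₆, WeierstrassCurve.b₈, Polynomial.eval_add,
      Polynomial.eval_mul, Polynomial.eval_C, Polynomial.eval_X, Polynomial.eval_pow,
      Polynomial.eval_ofNat]
    ring
  rw [e]
  push_cast
  convert key_mem a b (-10 * x ^ 2 - 2 * a) (-8 * x) (-16) using 1
  linear_combination (-(10 : R) * a * x ^ 4 - 40 * b * x ^ 3) * hw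

/-- **`preΨₙ(x) ≡ cuspJet n (mod (a, b)²)`**: the univariate division polynomials of
`y² = x³ + ax + b`, evaluated at `x ∈ R`, agree modulo `(a, b)²` with the closed forms.
[cite: SilvermanAEC2009, Exercise 3.7(a),(b) (PDF pp. 97–98)] -/
theorem mk_eval_preΨ' (n : ℕ) :
    Ideal.Quotient.mk (cuspIdealSq a b) (((shortCurve a b).preΨ' n).eval x) =
      jetQuotHom a b (cuspJet x w n) := by
  rw [WeierstrassCurve.preΨ', ← Polynomial.coe_evalRingHom, map_preNormEDS', map_preNormEDS',
    ← preNormEDS'_jet (x := x) (w := w) n, map_preNormEDS', Polynomial.coe_evalRingHom,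
    mk_eval_Ψ₂Sq_sq x a b hw, mk_eval_Ψ₃ x a b hw, mk_eval_preΨ₄ x a b hw]

/-- **Odd division polynomials to first order at the cusp**: for `n = 2j + 3`,
`ψₙ(x) - [n x^{(n²-1)/2} + a·14n(n²-1)(n²+6)w·x^{(n²-5)/2} + b·4n(n²-1)(n⁴+n²+15)w·x^{(n²-7)/2}]`
lies in `(a, b)²` (`840 w = 1`). [cite: SilvermanAEC2009, Exercise 3.7(a),(b) (PDF pp. 97–98)] -/
theorem preΨ'_eval_sub_cuspLinear_mem (j : ℕ) :
    ((shortCurve a b).preΨ' (2 * j + 3)).eval x -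
      ((2 * j + 3 : R) * x ^ (2 * j ^ 2 + 6 * j + 4) +
        a * (14 * (2 * j + 3 : R) * ((2 * j + 3) ^ 2 - 1) * ((2 * j + 3) ^ 2 + 6) * w *
          x ^ (2 * j ^ 2 + 6 * j + 2)) +
        b * (4 * (2 * j + 3 : R) * ((2 * j + 3) ^ 2 - 1) *
          (((2 * j + 3) ^ 2) ^ 2 + (2 * j + 3) ^ 2 + 15) * w * x ^ (2 * j ^ 2 + 6 * j + 1))) ∈
      cuspIdealSq a b := by
  rw [← Ideal.Quotient.eq, mk_eval_preΨ' x a b hw, cuspJet_odd, cuspJetOdd, jetQuotHom_jet]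

/-- **Even division polynomials (divided by `ψ₂`) to first order at the cusp**: for `n = 2j + 4`,
`preΨₙ(x) - [(n/2) x^{(n²-4)/2} + a·7n(n²-4)(n²+9)w·x^{(n²-8)/2}
  + b·2n(n²-4)(n⁴+4n²+30)w·x^{(n²-10)/2}]` lies in `(a, b)²` (`840 w = 1`).
[cite: SilvermanAEC2009, Exercise 3.7(a),(b) (PDF pp. 97–98)] -/
theorem preΨ'_eval_sub_cuspLinear_mem_even (j : ℕ) :
    ((shortCurve a b).preΨ' (2 * j + 4)).eval x -
      ((j + 2 : R) * x ^ (2 * j ^ 2 + 8 * j + 6) +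
        a * (7 * (2 * j + 4 : R) * ((2 * j + 4) ^ 2 - 4) * ((2 * j + 4) ^ 2 + 9) * w *
          x ^ (2 * j ^ 2 + 8 * j + 4)) +
        b * (2 * (2 * j + 4 : R) * ((2 * j + 4) ^ 2 - 4) *
          (((2 * j + 4) ^ 2) ^ 2 + 4 * (2 * j + 4) ^ 2 + 30) * w * x ^ (2 * j ^ 2 + 8 * j + 3))) ∈
      cuspIdealSq a b := by
  rw [← Ideal.Quotient.eq, mk_eval_preΨ' x a b hw, cuspJet_even, cuspJetEven, jetQuotHom_jet]

/-- **The leading congruence for odd `n`**: `ψₙ(x) - n·x^{(n²-1)/2} ∈ (na, nb) + (a, b)²` for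
`n = 2j + 3` — both first-order coefficients carry the factor `n` (`840` invertible).
[cite: SilvermanAEC2009, Exercise 3.7(a),(b) (PDF pp. 97–98)] -/
theorem preΨ'_eval_sub_leading_mem (j : ℕ) :
    ((shortCurve a b).preΨ' (2 * j + 3)).eval x - (2 * j + 3 : R) * x ^ (2 * j ^ 2 + 6 * j + 4) ∈
      Ideal.span {(2 * j + 3 : R) * a, (2 * j + 3 : R) * b} ⊔ cuspIdealSq a b := by
  have h := preΨ'_eval_sub_cuspLinear_mem x a b hw j
  set P := ((shortCurve a b).preΨ' (2 * j + 3)).eval x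
  have hna : (2 * j + 3 : R) * a ∈ Ideal.span {(2 * j + 3 : R) * a, (2 * j + 3 : R) * b} :=
    Ideal.subset_span (by simp)
  have hnb : (2 * j + 3 : R) * b ∈ Ideal.span {(2 * j + 3 : R) * a, (2 * j + 3 : R) * b} :=
    Ideal.subset_span (by simp)
  have e : P - (2 * j + 3 : R) * x ^ (2 * j ^ 2 + 6 * j + 4) =
      ((2 * j + 3 : R) * a * (14 * ((2 * j + 3) ^ 2 - 1) * ((2 * j + 3) ^ 2 + 6) * w *
          x ^ (2 * j ^ 2 + 6 * j + 2)) +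
        (2 * j + 3 : R) * b * (4 * ((2 * j + 3) ^ 2 - 1) *
          (((2 * j + 3) ^ 2) ^ 2 + (2 * j + 3) ^ 2 + 15) * w * x ^ (2 * j ^ 2 + 6 * j + 1))) +
      (P - ((2 * j + 3 : R) * x ^ (2 * j ^ 2 + 6 * j + 4) +
        a * (14 * (2 * j + 3 : R) * ((2 * j + 3) ^ 2 - 1) * ((2 * j + 3) ^ 2 + 6) * w *
          x ^ (2 * j ^ 2 + 6 * j + 2)) +
        b * (4 * (2 * j + 3 : R) * ((2 * j + 3) ^ 2 - 1) *
          (((2 * j + 3) ^ 2) ^ 2 + (2 * j + 3) ^ 2 + 15) * w * x ^ (2 * j ^ 2 + 6 * j + 1)))) := by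
    ring
  rw [e]
  exact add_mem (Ideal.mem_sup_left (add_mem (Ideal.mul_mem_right _ _ hna)
    (Ideal.mul_mem_right _ _ hnb))) (Ideal.mem_sup_right h)

end Transfer

end Literature.NumberTheory.EllipticCurves.CuspJets

end
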